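import Literature.AnabelianGeometry.EtaleTheta.SettingModelKrullPiC
import Literature.AnabelianGeometry.EtaleTheta.SettingModelChiMuTwoInversion
import HarnessLib

/-!
# The cusped untwisted Krull model, file K5a: `Π^tp_Ẍ ≤ Π^tp_X = Γ ⋊_{θ∘1} G_{ℚ_p}` and the TEMPERED
# `Π^tp_C := Π^tp_X ⋊_ι ℤ/2` with `ε_±` realising the inversion `ι = twistedInversion 1`

S. Mochizuki, *The étale theta function and its Frobenioid-theoretic manifestations*, Publ. RIMS **45** (2009) [EtTh],
Def. 1.7, PRIMS PDF p. 27 (printed 253): «`C^log` … the stack-theoretic quotient of `X^log` by the natural action of `±1`»,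
«`Ẍ^log → X^log` … the Galois covering of degree `4` determined by the multiplication by `2` map», «`Gal(Ẍ^log/C^log) ≅
(ℤ/2ℤ)³`», «`ε_± ∈ Gal(Ẍ/C)`»; §2 p. 36 «`Π_X ⊆ Π_C`», «`ι` … “multiplication by `−1`”» [cite: MochizukiEtTh2009, Def 1.7 p.27].
Cell abc-iut, layer L2, seat abc-iut-L2-t10 (gen 6), row «COR 2.8 (iii) OUTER-TRANSPORT NV AT THE KRULL CARRIER modelκ′»
(abc-iut-L2-lead R289/R308), file 1 of 3 (K5a → K5b `SettingModelKrullMuTwoInversion` → `Discharge/Sec2OuterTransportModelKrull`).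

WHY. The OUTER chain of [EtTh] Cor. 2.8 (iii) (abc-iut-w6-d051 lineage `Discharge/Sec2OrbitEmbeddingOuterTransport` /
`…OuterBinders` / `Sec2OuterPairOfCLevelData` / `Sec2OuterPairNonVacuity`) consumes a TEMPERED C-level record
`MuTwoSetting.CLevelData` (abc-iut-L2-d3), whereas gen 5's K4 (`SettingModelKrullPiC`) built only the PROFINITE
`Π_C = Π_X ⋊_{ι̂} ℤ/2` at `ThetaSetting.modelκ′ p` (`PiCκ`, `piCDataκ'`, `coverDataAxκ` with zero binders). This file is the
tempered level over the SAME root (`Π^tp_X = Γ ⋊_{θ∘1} G_{ℚ_p}`, commutator-axis cusp) — abc-iut-w5-d140's F8ι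
(`SettingModelChiMuTwoInversion`) transcribed with the cyclotomic character replaced by `1`, every Γ-level input BY NAME
(abc-iut-f-113's `xyTwo` / `dXdd` / `xyTwo_gfpOf`, abc-iut-w5-d140's `xyTwo_gfpInv`, abc-iut-w5-d072's `twistedInversion 1`):
* §1 `parityκ : Π^tp_X → ℤ/2 × ℤ/2` (a homomorphism: the action `actκ` is trivial), **`Xddκ := Ker parityκ`** (`Π^tp_Ẍ`:
  index `4`, normal, squares, `Π^tp_Ÿ ⊆ Π^tp_Ẍ`, `a, b, a·b⁻¹ ∉`, `ι`-stable, `g·ι(g) ∈ Π^tp_Ẍ`);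
* §2 `invActionκ : ℤ/2 → Aut(Π^tp_X)` (generator `↦ ι`), compatible with K4's completed action (`toHatκ_invActionκ`);
  **`PiCInvκ := Π^tp_X ⋊_ι ℤ/2`** (topology induced by `(left, right)` — instances on this NEW carrier only), `inclInvκ`
  (continuous OPEN EMBEDDING of normal index-`2` range), `toGalXCκ`, **`ε_± := inr 1̄`** with
  **`ε_± · inclX x · ε_±⁻¹ = inclX (ι x)`** (`epsPM_conj_inlκ`), `epsZInvκ := a`, `inclX(Π^tp_Ẍ)` normal, the square law.

HONEST LIMITS: SEMI-SYNTHETIC model (untwisted: `G_{ℚ_p}` acts trivially on `Γ`; not the tempered `π₁` of an orbicurve) —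
consistency / non-vacuity evidence for the typed interface ONLY. Class (b) construction (no interface clause touched):
definitions `parityκ`, `Xddκ`, `invActionκ`, the carrier `PiCInvκ` (+ `TopologicalSpace` / `IsTopologicalGroup` instances on it),
`inclInvκ`, `toGalXCκ`, `epsPMInvκ`, `epsZInvκ`; no `Prop` fact; nothing of [EtTh] asserted; no side taken on [IUTchIII]
Cor. 3.12; typed ≠ proved; instantiated ≠ endorsed.
-/

noncomputable section

namespace Literature.AnabelianGeometry.EtaleTheta.SettingModel

open Literature.AnabelianGeometry.SemiGraphs
open _root_.Topology _root_.Function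

variable (p : ℕ) [Fact p.Prime]

/-! ## §1. `Π^tp_Ẍ ≤ Π^tp_X = Γ ⋊_{θ∘1} G_{ℚ_p}` -/

/-- In `ℤ/2ℤ` every element is `2`-torsion. [folklore] -/
private theorem add_self_zmod_two_κ (a : ZMod ((2 : ℕ+) : ℕ)) : a + a = 0 := by
  revert a
  decide

/-- `xyTwo` is invariant under the (trivial) Galois action `actκ`. [cite: MochizukiEtTh2009, Def 1.7 p.27] -/
theorem xyTwo_actκ (σ : GQp p) (γ : Gfp) : xyTwo (actκ p σ γ) = xyTwo γ := by
  rw [actκ_apply_eq]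

/-- **The parity character of `Π^tp_X = Γ ⋊_{θ∘1} G_{ℚ_p}`**: `g ↦ (x, y) mod 2` of the level-`2` Heisenberg shadow of
`g.left` (abc-iut-f-113's `xyTwo`). DEFINED. [cite: MochizukiEtTh2009, Def 1.7 p.27] -/
def parityκ : PiTpκ p →* Multiplicative (ZMod ((2 : ℕ+) : ℕ)) × Multiplicative (ZMod ((2 : ℕ+) : ℕ)) :=
  Semidirect.leftHom xyTwo (xyTwo_actκ p)

/-- [cite: MochizukiEtTh2009, Def 1.7 p.27] -/
theorem parityκ_apply (g : PiTpκ p) : parityκ p g = xyTwo g.left := rfl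

/-- [cite: MochizukiEtTh2009, Def 1.7 p.27] -/
theorem parityκ_inl (γ : Gfp) : parityκ p (SemidirectProduct.inl γ) = xyTwo γ := by
  rw [parityκ_apply, SemidirectProduct.left_inl]

/-- `parityκ` is surjective. [cite: MochizukiEtTh2009, Def 1.7 p.27] -/
theorem parityκ_surjective : Surjective (parityκ p) :=
  Semidirect.leftHom_surjective xyTwo (xyTwo_actκ p) xyTwo_surjective

/-- **`Π^tp_Ẍ := Ker parityκ = Δ^tp_Ẍ ⋊ G_{ℚ_p}`** («`Ẍ^log → X^log` … of degree `4`»; `K = K̈ = ℚ_p` at the model).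
DEFINED. [cite: MochizukiEtTh2009, Def 1.7 p.27] -/
def Xddκ : Subgroup (PiTpκ p) := (parityκ p).ker

/-- [cite: MochizukiEtTh2009, Def 1.7 p.27] -/
theorem mem_Xddκ_iff (g : PiTpκ p) : g ∈ Xddκ p ↔ g.left ∈ dXdd := by
  rw [Xddκ, MonoidHom.mem_ker, dXdd, MonoidHom.mem_ker, parityκ_apply]

/-- `Π^tp_Ẍ` is normal in `Π^tp_X`. [cite: MochizukiEtTh2009, Def 1.7 p.27] -/
theorem Xddκ_normal : (Xddκ p).Normal := inferInstanceAs (parityκ p).ker.Normal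

/-- `[Π^tp_X : Π^tp_Ẍ] = 4`. [cite: MochizukiEtTh2009, Def 1.7 p.27] -/
theorem index_Xddκ : (Xddκ p).index = 4 := by
  rw [Xddκ, Subgroup.index_ker, MonoidHom.range_eq_top.mpr (parityκ_surjective p), Subgroup.card_top]
  show Nat.card (ZMod 2 × ZMod 2) = 4
  rw [Nat.card_prod, Nat.card_zmod]

/-- Every square of `Π^tp_X` lies in `Π^tp_Ẍ`. [cite: MochizukiEtTh2009, Def 1.7 p.27] -/
theorem mul_self_mem_Xddκ (g : PiTpκ p) : g * g ∈ Xddκ p := by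
  rw [Xddκ, MonoidHom.mem_ker, map_mul, parityκ_apply, xyTwo_apply, Prod.mk_mul_mk, Prod.mk_eq_one,
    ← ofAdd_add, ← ofAdd_add, add_self_zmod_two_κ, add_self_zmod_two_κ]
  exact ⟨rfl, rfl⟩

/-- `Π^tp_Ÿ ≤ Π^tp_Ẍ` at `modelκ′` (`Π^tp_Ÿ ⊆ Π^tp_{Y₂} = Δ^tp_{Y₂} ⋊ G_{K₂}`). [cite: MochizukiEtTh2009, Def 1.7 p.27] -/
theorem gtpYdd_modelκ'_le_Xddκ : (ThetaSetting.modelκ' p).GtpYdd ≤ Xddκ p := by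
  intro x hx
  have h1 : x ∈ YNκ p (2 * 1) := hx.1
  have h2 : x.left ∈ dY (2 * 1) := ((krullTwistData p).mem_YN.mp h1).1
  have h3 : (2 * 1 : ℕ+) = 2 := rfl
  rw [h3] at h2
  exact (mem_Xddκ_iff p x).mpr (dY_two_le_dXdd h2)

/-- `a ∉ Π^tp_Ẍ` (parity `(1, 0)`). [cite: MochizukiEtTh2009, Def 1.7 p.27] -/
theorem inl_gfpOf_zero_not_mem_Xddκ : (SemidirectProduct.inl (gfpOf (FreeGroup.of 0)) : PiTpκ p) ∉ Xddκ p := by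
  rw [Xddκ, MonoidHom.mem_ker, parityκ_inl, xyTwo_gfpOf, heisHom_of_zero, Prod.mk_eq_one]
  rintro ⟨h, -⟩
  revert h
  decide

/-- `b ∉ Π^tp_Ẍ` (parity `(0, 1)`). [cite: MochizukiEtTh2009, Def 1.7 p.27] -/
theorem inl_gfpOf_one_not_mem_Xddκ : (SemidirectProduct.inl (gfpOf (FreeGroup.of 1)) : PiTpκ p) ∉ Xddκ p := by
  rw [Xddκ, MonoidHom.mem_ker, parityκ_inl, xyTwo_gfpOf, heisHom_of_one, Prod.mk_eq_one]
  rintro ⟨-, h⟩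
  revert h
  decide

/-- `a · b⁻¹ ∉ Π^tp_Ẍ` (parity `(1, 1)`: `ε_Z := a` is `≠ ε_μ := b` in `Gal(Ẍ/X)`). [cite: MochizukiEtTh2009, Def 1.7 p.27] -/
theorem inl_gfpOf_zero_mul_inv_not_mem_Xddκ :
    (SemidirectProduct.inl (gfpOf (FreeGroup.of 0)) : PiTpκ p) *
        (SemidirectProduct.inl (gfpOf (FreeGroup.of 1)))⁻¹ ∉ Xddκ p := by
  rw [Xddκ, MonoidHom.mem_ker, map_mul, map_inv, parityκ_inl, parityκ_inl, xyTwo_gfpOf, xyTwo_gfpOf,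
    heisHom_of_zero, heisHom_of_one, Prod.inv_mk, Prod.mk_mul_mk, Prod.mk_eq_one]
  rintro ⟨h, -⟩
  revert h
  decide

/-- **`ι` fixes the parity character**: `parityκ (ι g) = parityκ g` (`ĥ₂ ∘ ι_Γ = negXY ∘ ĥ₂`, `−t = t` mod `2` —
abc-iut-w5-d140's `xyTwo_gfpInv`). [cite: MochizukiEtTh2009, Prop 2.2 (i) p.37] -/
theorem parityκ_twistedInversion (g : PiTpκ p) :
    parityκ p (twistedInversion (1 : GQp p →* MulAut ZH) g) = parityκ p g := by
  rw [parityκ_apply, parityκ_apply, twistedInversion_left, xyTwo_gfpInv]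

/-- **`Π^tp_Ẍ` is `ι`-stable.** [cite: MochizukiEtTh2009, Def 1.7 p.27] -/
theorem twistedInversion_mem_Xddκ_iff (g : PiTpκ p) :
    twistedInversion (1 : GQp p →* MulAut ZH) g ∈ Xddκ p ↔ g ∈ Xddκ p := by
  rw [Xddκ, MonoidHom.mem_ker, MonoidHom.mem_ker, parityκ_twistedInversion]

/-- **`g · ι(g) ∈ Π^tp_Ẍ`** (the square law `(g, ε_±)² = (g·ι g, 1)` of `Gal(Ẍ/C) ≅ (ℤ/2)³`).
[cite: MochizukiEtTh2009, Def 1.7 p.27] -/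
theorem mul_twistedInversion_mem_Xddκ (g : PiTpκ p) : g * twistedInversion (1 : GQp p →* MulAut ZH) g ∈ Xddκ p := by
  have h := mul_self_mem_Xddκ p g
  rw [Xddκ, MonoidHom.mem_ker, map_mul] at h ⊢
  rwa [parityκ_twistedInversion]

/-! ## §2. `Π^tp_C := Π^tp_X ⋊_ι ℤ/2` over `modelκ′` -/

/-- `ι ∘ ι = 1` in `Aut(Π^tp_X)`. [cite: MochizukiEtTh2009, §2 p.36] -/
theorem twistedInversion_one_mul_self :
    twistedInversion (1 : GQp p →* MulAut ZH) * twistedInversion (1 : GQp p →* MulAut ZH) = (1 : MulAut (PiTpκ p)) :=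
  MulEquiv.ext fun g => twistedInversion_twistedInversion (1 : GQp p →* MulAut ZH) g

/-- **The action `ℤ/2 → Aut(Π^tp_X)`, generator `↦ ι := twistedInversion 1`** (well defined since `ι² = 1`). DEFINED.
[cite: MochizukiEtTh2009, Def 1.7 p.27] -/
def invActionκ : Multiplicative (ZMod 2) →* MulAut (PiTpκ p) where
  toFun z := if z = 1 then 1 else twistedInversion (1 : GQp p →* MulAut ZH)
  map_one' := if_pos rfl
  map_mul' a b := by
    have key : ∀ z : Multiplicative (ZMod 2), z = 1 ∨ z = Multiplicative.ofAdd 1 := by decide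
    have hne : (Multiplicative.ofAdd (1 : ZMod 2)) ≠ 1 := by decide
    have hsq : Multiplicative.ofAdd (1 : ZMod 2) * Multiplicative.ofAdd 1 = 1 := by decide
    rcases key a with rfl | rfl <;> rcases key b with rfl | rfl
    · simp
    · simp [hne]
    · simp [hne]
    · rw [hsq, if_pos rfl, if_neg hne, twistedInversion_one_mul_self]

/-- The generator acts by `ι`. [cite: MochizukiEtTh2009, Def 1.7 p.27] -/
theorem invActionκ_ofAdd_one : invActionκ p (Multiplicative.ofAdd 1) = twistedInversion (1 : GQp p →* MulAut ZH) := by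
  change (if Multiplicative.ofAdd (1 : ZMod 2) = 1 then (1 : MulAut (PiTpκ p)) else twistedInversion 1) = _
  rw [if_neg (by decide)]

/-- `φ(z)` is `1` or `ι`. [cite: MochizukiEtTh2009, Def 1.7 p.27] -/
theorem invActionκ_eq (z : Multiplicative (ZMod 2)) :
    invActionκ p z = 1 ∨ invActionκ p z = twistedInversion (1 : GQp p →* MulAut ZH) := by
  have key : ∀ z : Multiplicative (ZMod 2), z = 1 ∨ z = Multiplicative.ofAdd 1 := by decide
  rcases key z with rfl | rfl
  · exact Or.inl (map_one _)
  · exact Or.inr (invActionκ_ofAdd_one p)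

/-- Each `φ(z)` is continuous on `Π^tp_X`. [cite: MochizukiEtTh2009, §2 p.36] -/
theorem continuous_invActionκ_apply (z : Multiplicative (ZMod 2)) : Continuous (invActionκ p z : PiTpκ p → PiTpκ p) := by
  rcases invActionκ_eq p z with h | h <;> rw [h]
  · exact continuous_id
  · exact continuous_twistedInversion (1 : GQp p →* MulAut ZH) (isInducing_leftRightκ p)

/-- The action map `(z, g) ↦ φ(z)(g)` is jointly continuous (`ℤ/2` discrete). [cite: MochizukiEtTh2009, Def 1.7 p.27] -/
theorem continuous_invActionκ : Continuous fun q : Multiplicative (ZMod 2) × PiTpκ p => invActionκ p q.1 q.2 :=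
  continuous_prod_of_discrete_left.mpr fun z => continuous_invActionκ_apply p z

/-- `aug (φ(z) x) = aug x`: the action is over `G_{ℚ_p}`. [cite: Mochizuki2012, Rmk 1.4.1 (ii) p.28] -/
theorem augκ_invActionκ (z : Multiplicative (ZMod 2)) (x : PiTpκ p) : augκ p (invActionκ p z x) = augκ p x := by
  rcases invActionκ_eq p z with h | h <;> rw [h]
  · rfl
  · rfl

/-- `toHat (φ(z) x) = φ̂(z) (toHat x)`: the tempered and completed `ℤ/2`-actions (K4's `hatInvActionκ`) agree along
`Π^tp_X ↪ Π_X` (`pr₁ (ι_Γ γ) = σ̂ (pr₁ γ)`). [cite: MochizukiEtTh2009, §2 p.36] -/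
theorem toHatκ_invActionκ (z : Multiplicative (ZMod 2)) (x : PiTpκ p) :
    toHatκ p (invActionκ p z x) = hatInvActionκ p z (toHatκ p x) := by
  have key : ∀ z : Multiplicative (ZMod 2), z = 1 ∨ z = Multiplicative.ofAdd 1 := by decide
  rcases key z with rfl | rfl
  · rw [map_one, map_one, MulAut.one_apply, MulAut.one_apply]
  · rw [invActionκ_ofAdd_one, hatInvActionκ_ofAdd_one]
    exact SemidirectProduct.ext rfl rfl

/-- `g · φ(z)(g) ∈ Π^tp_Ẍ` for every `g`. [cite: MochizukiEtTh2009, Def 1.7 p.27] -/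
theorem mul_invActionκ_mem_Xddκ (z : Multiplicative (ZMod 2)) (g : PiTpκ p) : g * invActionκ p z g ∈ Xddκ p := by
  rcases invActionκ_eq p z with h | h <;> rw [h]
  · exact mul_self_mem_Xddκ p g
  · exact mul_twistedInversion_mem_Xddκ p g

/-- `φ(z)` preserves `Π^tp_Ẍ`. [cite: MochizukiEtTh2009, Def 1.7 p.27] -/
theorem invActionκ_mem_Xddκ (z : Multiplicative (ZMod 2)) {g : PiTpκ p} (hg : g ∈ Xddκ p) : invActionκ p z g ∈ Xddκ p := by
  rcases invActionκ_eq p z with h | h <;> rw [h]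
  · exact hg
  · exact (twistedInversion_mem_Xddκ_iff p g).mpr hg

/-- **`Π^tp_C := Π^tp_X ⋊_ι ℤ/2`** — the model of the tempered fundamental group of `C^log = X^log/{±1}` over the cusped
untwisted Krull root (a type synonym of Mathlib's semidirect product). DEFINED. [cite: MochizukiEtTh2009, Def 1.7 p.27] -/
abbrev PiCInvκ : Type := PiTpκ p ⋊[invActionκ p] Multiplicative (ZMod 2)

/-- The topology of `Π^tp_C`: induced along `g ↦ (g.left, g.right) ∈ Π^tp_X × ℤ/2` — an instance on the NEW carrier only.
[cite: MochizukiEtTh2009, Def 1.7 p.27] -/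
instance instTopologicalSpacePiCInvκ : TopologicalSpace (PiCInvκ p) :=
  TopologicalSpace.induced (fun g : PiCInvκ p => (g.left, g.right)) inferInstance

/-- `g ↦ (g.left, g.right)` is inducing on `Π^tp_C`. [cite: MochizukiEtTh2009, Def 1.7 p.27] -/
theorem isInducing_leftRightCInvκ : IsInducing fun g : PiCInvκ p => (g.left, g.right) := ⟨rfl⟩

/-- **`Π^tp_C` is a topological group.** [cite: MochizukiEtTh2009, Def 1.7 p.27] -/
instance instIsTopologicalGroupPiCInvκ : IsTopologicalGroup (PiCInvκ p) :=
  haveI : IsTopologicalGroup (Multiplicative (ZMod 2)) :=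
    { continuous_mul := continuous_of_discreteTopology, continuous_inv := continuous_of_discreteTopology }
  Semidirect.isTopologicalGroup_of_continuous_action (isInducing_leftRightCInvκ p) (continuous_invActionκ p)

/-- `Π^tp_X ↪ Π^tp_C`: the normal factor. DEFINED. [cite: MochizukiEtTh2009, Def 1.7 p.27] -/
def inclInvκ : PiTpκ p →* PiCInvκ p := SemidirectProduct.inl

/-- `Π^tp_C ↠ ℤ/2 = Gal(X/C)`. DEFINED. [cite: MochizukiEtTh2009, Def 1.7 p.27] -/
def toGalXCκ : PiCInvκ p →* Multiplicative (ZMod 2) := SemidirectProduct.rightHom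

/-- **`ε_± := (1, 1̄)`** — it lifts `−1`. DEFINED. [cite: MochizukiEtTh2009, Def 1.7 p.27] -/
def epsPMInvκ : PiCInvκ p := SemidirectProduct.inr (Multiplicative.ofAdd 1)

/-- `ε_Z := a` read in `Π^tp_C`. DEFINED. [cite: MochizukiEtTh2009, Def 1.7 p.27] -/
def epsZInvκ : PiCInvκ p := inclInvκ p (SemidirectProduct.inl (gfpOf (FreeGroup.of 0)))

/-- `Π^tp_X = Ker(Π^tp_C ↠ ℤ/2)`. [cite: MochizukiEtTh2009, Def 1.7 p.27] -/
theorem range_inclInvκ : (inclInvκ p).range = (toGalXCκ p).ker := SemidirectProduct.range_inl_eq_ker_rightHom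

/-- `Π^tp_C ↠ ℤ/2` is onto. [cite: MochizukiEtTh2009, Def 1.7 p.27] -/
theorem toGalXCκ_surjective : Surjective (toGalXCκ p) := SemidirectProduct.rightHom_surjective

/-- `Π^tp_X ↪ Π^tp_C` is continuous. [cite: MochizukiEtTh2009, Def 1.7 p.27] -/
theorem continuous_inclInvκ : Continuous (inclInvκ p) := Semidirect.continuous_inl (isInducing_leftRightCInvκ p)

/-- `Π^tp_C ↠ ℤ/2` is continuous. [cite: MochizukiEtTh2009, Def 1.7 p.27] -/
theorem continuous_toGalXCκ : Continuous (toGalXCκ p) := Semidirect.continuous_right (isInducing_leftRightCInvκ p)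

/-- The image of `Π^tp_X` is OPEN in `Π^tp_C`. [cite: MochizukiEtTh2009, Def 1.7 p.27] -/
theorem isOpen_range_inclInvκ : IsOpen ((inclInvκ p).range : Set (PiCInvκ p)) := by
  rw [range_inclInvκ, MonoidHom.coe_ker]
  exact (isOpen_discrete ({1} : Set (Multiplicative (ZMod 2)))).preimage (continuous_toGalXCκ p)

/-- **`inclX` induces the topology of `Π^tp_X`** ((R1d)). [cite: MochizukiEtTh2009, Def 1.7 p.27] -/
theorem isInducing_inclInvκ : IsInducing (inclInvκ p) := by
  rw [← (isInducing_leftRightCInvκ p).of_comp_iff]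
  exact isInducing_prodMkLeft (1 : Multiplicative (ZMod 2))

/-- `inclX : Π^tp_X ↪ Π^tp_C` is an OPEN EMBEDDING. [cite: MochizukiEtTh2009, Def 1.7 p.27] -/
theorem isOpenEmbedding_inclInvκ : IsOpenEmbedding (inclInvκ p) :=
  ⟨⟨isInducing_inclInvκ p, SemidirectProduct.inl_injective⟩, isOpen_range_inclInvκ p⟩

/-- **`ε_± · x · ε_±⁻¹ = ι(x)` on `Π^tp_X`**: conjugation by `ε_±` IS the twisted inversion (Mathlib
`SemidirectProduct.inl_aut`). [cite: MochizukiEtTh2009, §2 p.36] -/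
theorem epsPM_conj_inlκ (x : PiTpκ p) :
    epsPMInvκ p * inclInvκ p x * (epsPMInvκ p)⁻¹ = inclInvκ p (twistedInversion (1 : GQp p →* MulAut ZH) x) := by
  have h := SemidirectProduct.inl_aut (φ := invActionκ p) (Multiplicative.ofAdd (1 : ZMod 2)) x
  rw [invActionκ_ofAdd_one] at h
  change epsPMInvκ p * inclInvκ p x * (epsPMInvκ p)⁻¹ = SemidirectProduct.inl (twistedInversion 1 x)
  rw [h, epsPMInvκ, map_inv]
  rfl

/-- `ε_± ∉ inclX(Π^tp_X)`. [cite: MochizukiEtTh2009, Def 1.7 p.27] -/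
theorem epsPMInvκ_not_mem_range : epsPMInvκ p ∉ (inclInvκ p).range := by
  rintro ⟨y, hy⟩
  have h := congrArg (toGalXCκ p) hy
  change SemidirectProduct.rightHom (SemidirectProduct.inl y) =
    SemidirectProduct.rightHom (SemidirectProduct.inr (Multiplicative.ofAdd 1)) at h
  rw [SemidirectProduct.rightHom_inl, SemidirectProduct.rightHom_inr] at h
  exact absurd h (by decide)

/-- The image of `Π^tp_Ẍ` in `Π^tp_C` is normal (normal in `Π^tp_X` and `ι`-stable). [cite: MochizukiEtTh2009, Def 1.7 p.27] -/
theorem map_inclInvκ_Xddκ_normal : ((Xddκ p).map (inclInvκ p)).Normal := by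
  haveI := Xddκ_normal p
  refine ⟨?_⟩
  rintro _ ⟨h, hh, rfl⟩ y
  refine ⟨y.left * invActionκ p y.right h * y.left⁻¹,
    (Xddκ_normal p).conj_mem _ (invActionκ_mem_Xddκ p y.right hh) y.left, ?_⟩
  change SemidirectProduct.inl _ = y * SemidirectProduct.inl h * y⁻¹
  rw [map_mul, map_mul, map_inv, SemidirectProduct.inl_aut, map_inv]
  conv_rhs => rw [← SemidirectProduct.inl_left_mul_inr_right y]
  rw [mul_inv_rev]
  group

/-- The square of `(x, z)` is `(x · φ(z)(x), 1)`. [cite: MochizukiEtTh2009, Def 1.7 p.27] -/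
theorem sq_eq_inlκ (g : PiCInvκ p) :
    g * g = inclInvκ p (SemidirectProduct.left g * invActionκ p (SemidirectProduct.right g) (SemidirectProduct.left g)) := by
  have h2 : ∀ t : Multiplicative (ZMod 2), t * t = 1 := by decide
  refine SemidirectProduct.ext ?_ ?_
  · rfl
  · change SemidirectProduct.right g * SemidirectProduct.right g = 1
    exact h2 _

end Literature.AnabelianGeometry.EtaleTheta.SettingModel

end
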